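import Summits.BirchSwinnertonDyer.BirchSwinnertonDyer.Theorems.OneSidedTwistSqueezeX9KatoDivisibilityX9StubReciprocityPkX9Transfer
import Summits.BirchSwinnertonDyer.BirchSwinnertonDyer.Theorems.OneSidedTwistSqueezeX9KatoDivisibilityX9StubReciprocityPkX9Pairing
import Summits.BirchSwinnertonDyer.BirchSwinnertonDyer.Theorems.OneSidedTwistSqueezeX9KatoDivisibilityX9StubReciprocityPkX9Local
import Summits.BirchSwinnertonDyer.BirchSwinnertonDyer.Theorems.OneSidedTwistSqueezeX9KatoDivisibilityX9GradedCoreAssembly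
import HarnessLib

set_option autoImplicit false

-- the summit and its single problem are both named `BirchSwinnertonDyer` (registry layout D-0017)
set_option linter.dupNamespace false

/-!
# Stub 1c' `stub_reciprocityPkAX9` (hG34ᵍ, skeleton v4) of line `graded_euler_loss`, crux `KatoDivisibilityX9`
# (stmt-BirchSwinnertonDyer-20547) FROM ONE HYPOTHESIS `hKolyRecPk` — the v4 twin of `…StubReciprocityPkX9Assembly`
# (the lead's port: v4 drops the unused fullness hypothesis `T^J ψ̄ ≠ 0` of v3's stub; proof verbatim minus one binder) — the level-`p^{d+1}` Kolyvagin–reciprocity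
# package at an `E[p^{d+1}]`-split Kolyvagin prime; this file is the graded ASSEMBLY (transfer of `p^d` to the test
# side, reduction mod `p`, level change `2e(d+1) → 2e`, transport to the stub's Frobenius)

Seat `bsd-line-k6-p4` (prover-bsd-line-k6-p4-g5-0, 5th LEAD; port of the wave-1 worker's file p630884 to the v4 signature).  THEOREMS ONLY, sorry-free;
no definition, no named fact; nothing asserted about any curve: the level-`p^{d+1}` package enters as a HYPOTHESIS,
stated verbatim, exactly as lur-b's `StepsTwoFour.stub_stepsTwoFourOdd_of (hKoly)` did at `n = 0`.
`--supports stmt-BirchSwinnertonDyer-20547 --as helper`.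

THE HYPOTHESIS `hKolyRecPk` = what is MISSING in the tree for stub 1c: the `n = 0` pair `TameClass.hKoly_holds` ∧
`LocalSplitPrime.convCoeff_eq_zero_of_transverse_of_unramified` PORTED from `twistModP` to the T6a carrier `modPkTwist`
at level `L = 2e(d+1)`, with the Kolyvagin value folded in.  For the genuine Euler system class `s`, `k = d+1`,
`e = p^N`, `d ≤ N`, a finite `S₀`: for every cocycle `φ` of the level-`p^{d+1}` class `red^{(d+1)}(s)_L`
(T6c `IwasawaH1Data.redTowerPk`), every test class `Ψ ∈ H¹(ℚ, 𝒯^{(d+1)}_L(E)(κ⁻¹))` with the two local clauses of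
hG1ᵍ VERBATIM and cocycle `Ψ̃`, every equivariant alternating right-non-degenerate `μ_{p^{d+1}}`-valued biadditive `e_k`
on `E[p^{d+1}]`, every `E[p^{d+1}]`-split arithmetic Frobenius `Fr` at `q ∉ S₁ ⊇ S₀` of depth exactly `N`: there are a
local arithmetic Frobenius `r` of `ℚ_q` and `V, U ∈ ℤ[X]`, `p ∤ U(0)`, `V·ω_N ≡ 0 (mod p^{d+1}, X^L)`
(`ω_N = (X+1)^e − 1`), `V ≡ U·X^{L−e} (mod p, X^L)`, with `C^{e_k}_i(V(S)·φ(res r), Ψ̃(res r)) = 0` for `i + ε < L`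
(MEMO-es §15 STEPS 3–4: the Kolyvagin class of `s` over `Λ/(p^{d+1}, ω²)`, embedded in the `T^L`-carrier by `T^L/ω²`,
has value `V(S)φ(r)`, `V = unit·T^L/ω`; Poitou–Tate + the level-`p^{d+1}` `q`-term identity give the vanishing).

THE ASSEMBLY: apply the package to `φ := p^d φ'`, `φ'` a cocycle of `red^{(d+1)}(s')_L` (`s = p^d s'`) and a Weil pairing
`e_k` at level `p^{d+1}`; move `p^d` to the test side, where `p^d Ψ̃ = ι∘ψ̃ + ∂b` and `V(S)` kills `∂b(r)`
(`…Transfer`, `…Local`); change the pairing along `E[p] ⊂ E[p^{d+1}]`, `P ↦ p^d P`, `μ_p ⊂ μ_{p^{d+1}}` — the descent of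
`e_k` is a UNIT multiple of the stub's `eW` (`…Pairing.exists_unit_descent`); replace `V` by `U·X^{L−e}` against the
`p`-torsion test vector; change the level `L → 2e`; identify the truncated mod-`p` shadow of `φ'` with `S^a Φ` and of `ψ̃`
with `Ψc` up to coboundaries killed by `S^e`; transport `res r ↦ Fr` (x9 `…StepsTwoFourPairTransport`).

HONEST LABEL: `hKolyRecPk` is OPEN (the tame value input of `IsEulerSystemClass` mod `p^{d+1}`, the Kolyvagin cocycle
and the local `q`-term identity exist in the tree only for `twistModP`); the registered stub `stub_reciprocityPkX9`
stays OPEN; this file closes nothing; crux 20547 / B2 untouched; beyond-print theorem toward BSD: NO.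

References: B. Mazur, K. Rubin, Mem. AMS 799 (2004) Prop. 1.3.2, §4.4, §5.3 [MazurRubin2004]; K. Kato, Astérisque 295
(2004) §13.3, §13.8, Thm. 13.4 [Kato2004Asterisque]; J. S. Milne, ADT I Thm. 4.10 [MilneADT2006]; J. H. Silverman, AEC
III.8.1 [SilvermanAEC2009]; HOME/MEMO-es.md §15 STEPS 3–4, §25.2.
-/

noncomputable section

open scoped NumberField ContRepresentation
open Polynomial Field IsDedekindDomain
open Literature.NumberTheory.GaloisRepresentations
open Literature.NumberTheory.GaloisRepresentations.IsNonarchimedeanLocalField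
open Literature.NumberTheory.GaloisCohomology
open Literature.NumberTheory.EllipticCurves
open Literature.NumberTheory.EllipticCurves.Kato2004
open Literature.NumberTheory.EllipticCurves.Kato2004.EulerSystemValues
open WeierstrassCurve (geomPoints geomTorsion galoisRepTorsion)
open Summit.BirchSwinnertonDyer.BirchSwinnertonDyer.Rank1Residual
open Summit.BirchSwinnertonDyer.BirchSwinnertonDyer.Rank1Residual.CoreAssembly
open Summit.BirchSwinnertonDyer.BirchSwinnertonDyer.Theorems.OneSidedTwistSqueezeX9KatoDivisibilityX9StubReciprocityPkX9Transfer
open Summit.BirchSwinnertonDyer.BirchSwinnertonDyer.Theorems.OneSidedTwistSqueezeX9KatoDivisibilityX9StubReciprocityPkX9Pairing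
open Summit.BirchSwinnertonDyer.BirchSwinnertonDyer.Theorems.OneSidedTwistSqueezeX9KatoDivisibilityX9StubReciprocityPkX9Local

namespace Summit.BirchSwinnertonDyer.BirchSwinnertonDyer.Theorems.OneSidedTwistSqueezeX9KatoDivisibilityX9StubReciprocityPkAX9Assembly

-- heartbeat head-room for the 150-line statement (two 70-line formulas) and the long context; own budget line
set_option maxHeartbeats 800000 in
/-- **The registered stub `stub_reciprocityPkAX9` (hG34ᵍ of the bounded-defect graded core assembly, skeleton v4) from the level-`p^{d+1}`
Kolyvagin–reciprocity package `hKolyRecPk`** (module docstring).  MEMO-es §15 STEP 4: transfer of `p^d` to the test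
side, reduction mod `p` through a unit multiple of the Weil pairing, level change, transport.
[cite: MazurRubin2004, Prop. 1.3.2, §4.4 and §5.3] [cite: Kato2004Asterisque, §13.3 and Thm. 13.4 (p. 226)]
[cite: SilvermanAEC2009, III.§8 (Prop. 8.1)] -/
theorem stub_reciprocityPkAX9_of_kolyvaginReciprocityPk
    (hKolyRecPk : ∀ (W : WeierstrassCurve ℚ) [W.IsElliptic] [W.IsGloballyMinimal] (p : ℕ) [Fact p.Prime]
      [ContinuousSMul ℤ_[p] (W.tateModule p)] [Module.Free ℤ_[p] (W.tateModule p)]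
      [Module.Finite ℤ_[p] (W.tateModule p)]
      (κ : ZpExtension ℚ p) (γ : absoluteGaloisGroup ℚ) (I : IwasawaH1Data W p κ γ),
      p ≠ 2 → W.HasIrreducibleModPGaloisRep p → ¬ W.HasSurjectiveModNGaloisRep p →
      κ.IsCyclotomic → κ.IsTopGenerator γ →
      poitouTate_sum_localTatePairing_eq_zero ℚ →
      ∀ (s : I.H), IsEulerSystemClass W p κ γ I s → ∀ (d : ℕ),
      ∃ (S₀ : Set (HeightOneSpectrum (𝓞 ℚ))), S₀.Finite ∧
      ∀ (N e' : ℕ), e' + 1 = p ^ N → d ≤ N →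
      ∀ (J : ℕ), J + 1 = (2 * e' + 1 + 1) * (d + 1) →
      ∀ (φ : contOneCocycles (W.modPkTwist p (d + 1) κ (J + 1)).toTopRep),
      oneCocycleClass (W.modPkTwist p (d + 1) κ (J + 1)).toTopRep φ = (I.redTowerPk (d + 1) s).1 (J + 1) →
      ∀ (ε : ℕ) (S₁ : Set (HeightOneSpectrum (𝓞 ℚ))), S₀ ⊆ S₁ →
      ∀ (Ψ : galoisCohomology (W.modPkTwist p (d + 1) κ.invTwist (J + 1)) 1)
      (Ψc : contOneCocycles (W.modPkTwist p (d + 1) κ.invTwist (J + 1)).toTopRep),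
      oneCocycleClass (W.modPkTwist p (d + 1) κ.invTwist (J + 1)).toTopRep Ψc = Ψ →
      (∀ v : HeightOneSpectrum (𝓞 ℚ), v ∉ S₁ →
      galoisCohomology.localization (W.modPkTwist p (d + 1) κ.invTwist (J + 1)) (Sum.inr v) 1 Ψ ∈
      DiscreteGaloisModule.unramifiedSubgroup
      (GaloisRep.toLocal v (W.modPkTwist p (d + 1) κ.invTwist (J + 1))) 1) →
      (∀ v : HeightOneSpectrum (𝓞 ℚ), v ∈ S₁ →
      galoisCohomology.localization (W.modPkTwist p (d + 1) κ.invTwist (J + 1)) (Sum.inr v) 1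
      (galoisCohomology.map
      (κ.invTwist.twistModPkShiftEmbed (W.torsionGaloisModule ((p : ℤ) ^ (d + 1)))
      (W.pow_nsmul_geomTorsion_eq_zero p (d + 1)) (J + 1) (Nat.sub_le (J + 1) ε)) 1
      (galoisCohomology.map
      (κ.invTwist.twistModPkTruncate (W.torsionGaloisModule ((p : ℤ) ^ (d + 1)))
      (W.pow_nsmul_geomTorsion_eq_zero p (d + 1)) (J + 1) (Nat.sub_le (J + 1) ε)) 1 Ψ)) = 0) →
      ∀ (ek : geomTorsion W ((p : ℤ) ^ (d + 1)) →+ geomTorsion W ((p : ℤ) ^ (d + 1)) →+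
      DiscreteGaloisModule.MuCarrier ℚ (p ^ (d + 1))),
      (∀ (σ : absoluteGaloisGroup ℚ) (S T : geomTorsion W ((p : ℤ) ^ (d + 1))),
      ek (σ • S) (σ • T) = DiscreteGaloisModule.mu ℚ (p ^ (d + 1)) σ (ek S T)) →
      (∀ T, ek T T = 0) → (∀ T, (∀ S, ek S T = 0) → T = 0) →
      ∀ (q : HeightOneSpectrum (𝓞 ℚ)), q ∉ S₁ →
      ∀ 𝔓 ∈ q.primesAbove, ∀ (Fr : absoluteGaloisGroup ℚ), IsArithFrobAt (𝓞 ℚ) Fr 𝔓 →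
      galoisRepTorsion W ((p : ℤ) ^ (d + 1)) Fr = 1 →
      Fr ∈ κ.layerSubgroup N → Fr ∉ κ.layerSubgroup (N + 1) →
      ∃ (r : absoluteGaloisGroup (q.adicCompletion ℚ)), IsAbsArithFrob r ∧
      ∃ (V U : Polynomial ℤ), ¬ ((p : ℤ) ∣ U.coeff 0) ∧
      (∀ i : ℕ, i < J + 1 →
      (p : ℤ) ^ (d + 1) ∣ (V * ((Polynomial.X + 1 : Polynomial ℤ) ^ (e' + 1) - 1)).coeff i) ∧
      (∀ i : ℕ, i < J + 1 → (p : ℤ) ∣ (V - U * Polynomial.X ^ (J + 1 - (e' + 1))).coeff i) ∧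
      ∀ i : ℕ, i + ε < J + 1 →
      convCoeff ek (J + 1) i
      (Polynomial.aeval (shiftEnd (geomTorsion W ((p : ℤ) ^ (d + 1))) (J + 1)) V
      (φ.1 (absGaloisRestrict ℚ (q.adicCompletion ℚ) r)))
      (Ψc.1 (absGaloisRestrict ℚ (q.adicCompletion ℚ) r)) = 0) :
    ∀ (W : WeierstrassCurve ℚ) [W.IsElliptic] [W.IsGloballyMinimal] (p : ℕ) [Fact p.Prime]
      [ContinuousSMul ℤ_[p] (W.tateModule p)] [Module.Free ℤ_[p] (W.tateModule p)]
      [Module.Finite ℤ_[p] (W.tateModule p)]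
      (κ : ZpExtension ℚ p) (γ : absoluteGaloisGroup ℚ) (I : IwasawaH1Data W p κ γ),
      p ≠ 2 → W.HasIrreducibleModPGaloisRep p → ¬ W.HasSurjectiveModNGaloisRep p →
      κ.IsCyclotomic → κ.IsTopGenerator γ →
      poitouTate_sum_localTatePairing_eq_zero ℚ →
      ∀ (s : I.H), IsEulerSystemClass W p κ γ I s →
      ∀ (d : ℕ) (s' : I.H), s = ((PowerSeries.C (p : ℤ_[p]) : IwasawaAlgebra p) ^ d) • s' →
      ∃ (S₀ : Set (HeightOneSpectrum (𝓞 ℚ))), S₀.Finite ∧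
        ∀ (a : ℕ) (κ' : κ.twistTower (W.torsionGaloisModule (p : ℤ))
            (fun P : geomTorsion W (p : ℤ) => AddSubgroup.torsionBy.nsmul P)),
          (κ.towerShift (W.torsionGaloisModule (p : ℤ))
              (fun P : geomTorsion W (p : ℤ) => AddSubgroup.torsionBy.nsmul P))^[a] κ' = I.redTower s' →
          ∀ (N e' : ℕ), e' + 1 = p ^ N → d ≤ N →
          ∀ (Φ : contOneCocycles (W.modPTwist p κ (2 * e' + 1 + 1)).toTopRep),
            oneCocycleClass (W.modPTwist p κ (2 * e' + 1 + 1)).toTopRep Φ = κ'.1 (2 * e' + 1 + 1) →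
          ∀ (J : ℕ), J + 1 = (2 * e' + 1 + 1) * (d + 1) → ∀ (hJe : 2 * e' + 1 + 1 ≤ J + 1),
          ∀ (ε : ℕ) (S₁ : Set (HeightOneSpectrum (𝓞 ℚ)))
            (ι : (W.torsionGaloisModule (p : ℤ)).toContRepresentation →ⁱL
              (W.torsionGaloisModule ((p : ℤ) ^ (d + 1))).toContRepresentation),
            (∀ P : geomTorsion W (p : ℤ),
              ((ι P : geomTorsion W ((p : ℤ) ^ (d + 1))) : geomPoints W) = (P : geomPoints W)) →
          ∀ (Ψ : galoisCohomology (W.modPkTwist p (d + 1) κ.invTwist (J + 1)) 1)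
            (ψb : galoisCohomology (W.modPTwist p κ.invTwist (J + 1)) 1)
            (Ψc : contOneCocycles (W.modPTwist p κ.invTwist (2 * e' + 1 + 1)).toTopRep),
            S₀ ⊆ S₁ →
            oneCocycleClass (W.modPTwist p κ.invTwist (2 * e' + 1 + 1)).toTopRep Ψc =
              κ.invTwist.truncH1 (W.torsionGaloisModule (p : ℤ))
                (fun P : geomTorsion W (p : ℤ) => AddSubgroup.torsionBy.nsmul P) hJe ψb →
            p ^ d • Ψ = galoisCohomology.map
              (κ.invTwist.twistModPToModPk (W.torsionGaloisModule (p : ℤ)) (J + 1)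
                (W.torsionGaloisModule ((p : ℤ) ^ (d + 1)))
                (fun P : geomTorsion W (p : ℤ) => AddSubgroup.torsionBy.nsmul P)
                (W.pow_nsmul_geomTorsion_eq_zero p (d + 1)) ι) 1 ψb →
            (∀ v : HeightOneSpectrum (𝓞 ℚ), v ∉ S₁ →
              galoisCohomology.localization (W.modPkTwist p (d + 1) κ.invTwist (J + 1)) (Sum.inr v) 1 Ψ ∈
                DiscreteGaloisModule.unramifiedSubgroup
                  (GaloisRep.toLocal v (W.modPkTwist p (d + 1) κ.invTwist (J + 1))) 1) →
            (∀ v : HeightOneSpectrum (𝓞 ℚ), v ∈ S₁ →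
              galoisCohomology.localization (W.modPkTwist p (d + 1) κ.invTwist (J + 1)) (Sum.inr v) 1
                (galoisCohomology.map
                  (κ.invTwist.twistModPkShiftEmbed (W.torsionGaloisModule ((p : ℤ) ^ (d + 1)))
                    (W.pow_nsmul_geomTorsion_eq_zero p (d + 1)) (J + 1) (Nat.sub_le (J + 1) ε)) 1
                  (galoisCohomology.map
                    (κ.invTwist.twistModPkTruncate (W.torsionGaloisModule ((p : ℤ) ^ (d + 1)))
                      (W.pow_nsmul_geomTorsion_eq_zero p (d + 1)) (J + 1) (Nat.sub_le (J + 1) ε)) 1 Ψ)) = 0) →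
          ∀ (eW : geomTorsion W (p : ℤ) → geomTorsion W (p : ℤ) → AlgebraicClosure ℚ)
            (hμ : ∀ S T, eW S T ^ p = 1)
            (hadd₁ : ∀ S₁' S₂' T, eW (S₁' + S₂') T = eW S₁' T * eW S₂' T)
            (hadd₂ : ∀ S T₁ T₂, eW S (T₁ + T₂) = eW S T₁ * eW S T₂),
            (∀ T, eW T T = 1) → (∀ T, (∀ S, eW S T = 1) → T = 0) →
            (∀ (σ : absoluteGaloisGroup ℚ) (S T : geomTorsion W (p : ℤ)), σ • eW S T = eW (σ • S) (σ • T)) →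
          ∀ (q : HeightOneSpectrum (𝓞 ℚ)), q ∉ S₁ →
          ∀ 𝔓 ∈ q.primesAbove, ∀ (Fr : absoluteGaloisGroup ℚ), IsArithFrobAt (𝓞 ℚ) Fr 𝔓 →
            galoisRepTorsion W ((p : ℤ) ^ (d + 1)) Fr = 1 →
            Fr ∈ κ.layerSubgroup N → Fr ∉ κ.layerSubgroup (N + 1) →
          ∃ U : Polynomial ℤ, ¬ ((p : ℤ) ∣ U.coeff 0) ∧
            ∀ i : ℕ, i + ε < 2 * e' + 1 + 1 →
              convCoeff (weilPairingHom W p eW hμ hadd₁ hadd₂) (2 * e' + 1 + 1) i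
                (Polynomial.aeval (shiftEnd (geomTorsion W (p : ℤ)) (2 * e' + 1 + 1)) U
                  ((shiftEnd (geomTorsion W (p : ℤ)) (2 * e' + 1 + 1) ^ (e' + 1 + a)) (Φ.1 Fr)))
                (Ψc.1 Fr) = 0 := by
  intro W _ _ p _ _ _ _ κ γ I hp2 hirr hns hκ hγ hPT s hES d s' hss'
  have hp : p.Prime := Fact.out
  haveI : NeZero p := ⟨hp.ne_zero⟩
  -- the package's exceptional set and the primes where `E[p]`, `E[p^{d+1}]` ramify or which divide `p`
  obtain ⟨S₀H, hS₀H, H'⟩ := hKolyRecPk W p κ γ I hp2 hirr hns hκ hγ hPT s hES d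
  clear hKolyRecPk
  obtain ⟨S₁', hS₁'fin, hS₁'⟩ :=
    TorsionUnramified.exists_finite_isUnramifiedAt_torsionGaloisModule W (K := ℚ) (p := p) hp.ne_zero
  obtain ⟨S₂', hS₂'fin, hS₂'⟩ :=
    TorsionUnramified.exists_finite_isUnramifiedAt_torsionGaloisModule W (K := ℚ) (p := p ^ (d + 1))
      (pow_ne_zero _ hp.ne_zero)
  refine ⟨S₀H ∪ (S₁' ∪ S₂'), hS₀H.union (hS₁'fin.union hS₂'fin), ?_⟩
  intro a κ' hκ'a N e' he hdN Φ hΦ J hJ hJe ε S₁ ι hι Ψ ψb Ψc hS₀₁ hΨc hpΨ hΨur hΨε eW hμ hadd₁ hadd₂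
    halt hnd hgal q hq 𝔓 h𝔓 Fr hFr hFr1 hFrN hFrN1
  obtain ⟨hqp, -, hur⟩ := hS₁' q fun h => hq (hS₀₁ (Or.inr (Or.inl h)))
  have hurk : GaloisRep.IsUnramifiedAt q (W.torsionGaloisModule ((p : ℤ) ^ (d + 1))) := by
    have h := (hS₂' q fun h => hq (hS₀₁ (Or.inr (Or.inr h)))).2.2
    rwa [Nat.cast_pow] at h
  have hNL : N ≤ J + 1 + (d + 1) := by have := Nat.lt_pow_self hp.one_lt (n := N); omega
  have hN2 : N ≤ 2 * e' + 1 + 1 := by have := Nat.lt_pow_self hp.one_lt (n := N); omega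
  -- a Weil pairing at level `p^{d+1}` and its bridge to `eW`
  obtain ⟨eK, hμK, hadd₁K, hadd₂K, haltK, hndK, hgalK⟩ :=
    W.exists_weilPairing_holds (p ^ (d + 1)) (hp.two_le.trans (Nat.le_self_pow (Nat.succ_ne_zero d) p))
      (Nat.cast_ne_zero.mpr (pow_ne_zero _ hp.ne_zero))
  let ek := W.powWeilPairingHom p (d + 1) eK hμK hadd₁K hadd₂K
  have hek_gal := powWeilPairingHom_smul_smul W p (d + 1) eK hμK hadd₁K hadd₂K hgalK
  have hek_alt := powWeilPairingHom_self W p (d + 1) eK hμK hadd₁K hadd₂K haltK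
  have hek_nd := powWeilPairingHom_right_nondegenerate W p (d + 1) eK hμK hadd₁K hadd₂K hndK
  let e₁ := weilPairingHom W p eW hμ hadd₁ hadd₂
  have he₁_alt : ∀ T, e₁ T T = 0 := weilPairingHom_self W p eW hμ hadd₁ hadd₂ halt
  have he₁_nd : ∀ T, (∀ S, e₁ S T = 0) → T = 0 :=
    StepsTwoFour.weilPairingHom_right_nondegenerate W p eW hμ hadd₁ hadd₂ hnd
  let ιh : geomTorsion W (p : ℤ) →+ geomTorsion W ((p : ℤ) ^ (d + 1)) := ι.toContinuousLinearMap.toLinearMap.toAddMonoidHom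
  let red := W.geomTorsionPowToModP p d
  let j := muInclusion ℚ (dvd_pow_succ_self (p := p) (d := d))
  obtain ⟨c, hpc, hbridge⟩ := exists_unit_descent ek hek_alt hek_nd e₁ he₁_alt he₁_nd ιh hι
  -- cocycles: `φ'` of `red^{(d+1)}(s')_L`, `Ψ̃` of `Ψ`, `ψ̃` of `ψb`
  obtain ⟨φ', hφ'⟩ : ∃ φ' : contOneCocycles (W.modPkTwist p (d + 1) κ (J + 1)).toTopRep,
      oneCocycleClass (W.modPkTwist p (d + 1) κ (J + 1)).toTopRep φ' = (I.redTowerPk (d + 1) s').1 (J + 1) :=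
    oneCocycleClass_surjective _ _
  have hφ : oneCocycleClass (W.modPkTwist p (d + 1) κ (J + 1)).toTopRep (p ^ d • φ') =
      (I.redTowerPk (d + 1) s).1 (J + 1) := by
    have h1 : oneCocycleClass (W.modPkTwist p (d + 1) κ (J + 1)).toTopRep (p ^ d • φ') =
        p ^ d • oneCocycleClass (W.modPkTwist p (d + 1) κ (J + 1)).toTopRep φ' := oneCocycleClass_nsmul _ (p ^ d) φ'
    rw [h1, hφ', hss']
    exact (redTowerPk_apply_C_pow_smul W p I (d + 1) d s' (J + 1)).symm
  obtain ⟨Ψt, hΨt⟩ := oneCocycleClass_surjective _ Ψ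
  obtain ⟨ψt, hψt⟩ := oneCocycleClass_surjective _ ψb
  -- THE PACKAGE at `q`
  obtain ⟨r, hr, V, U, hU0, hVω, hVU, hvan⟩ := H' N e' he hdN J hJ (p ^ d • φ') hφ ε S₁
    (fun v hv => hS₀₁ (Or.inl hv)) Ψ Ψt hΨt hΨur hΨε ek hek_gal hek_alt hek_nd q hq 𝔓 h𝔓 Fr hFr hFr1 hFrN hFrN1
  clear H'
  -- `res r` is `E[p^{d+1}]`-split (hence `E[p]`-split) of depth exactly `N`
  obtain ⟨hρkr, hrN, -⟩ := StepsTwoFourTransport.isSplit_and_depth_absGaloisRestrict_of_isArithFrobAt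
    (W.torsionGaloisModule ((p : ℤ) ^ (d + 1))) κ hurk hqp h𝔓 hFr
    (torsionGaloisModule_eq_one_of_galoisRepTorsion_eq_one W hFr1) hFrN hFrN1 hr
  have hρFr : galoisRepTorsion W (p : ℤ) Fr = 1 := galoisRepTorsion_natCast_eq_one_of_pow W p d hFr1
  obtain ⟨-, hρr, -, -⟩ :=
    StepsTwoFourTransport.isSplit_and_depth_absGaloisRestrict_of_isArithFrobAt_rat W p κ hur hqp h𝔓 hFr hρFr hFrN hFrN1 hr
  have hsplitk : ∀ P : geomTorsion W ((p : ℤ) ^ (d + 1)), absGaloisRestrict ℚ (q.adicCompletion ℚ) r • P = P :=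
    fun P => by
      have h := LinearMap.congr_fun hρkr P
      rwa [WeierstrassCurve.torsionGaloisModule_apply_apply, Module.End.one_apply] at h
  have hsplit1 : ∀ P : geomTorsion W (p : ℤ), absGaloisRestrict ℚ (q.adicCompletion ℚ) r • P = P :=
    smul_eq_of_galoisRepTorsion_eq_one W hρr
  have hrN' : absGaloisRestrict ℚ (q.adicCompletion ℚ) r ∈ κ.invTwist.layerSubgroup N := by
    rw [ZpExtension.layerSubgroup_invTwist]; exact hrN
  -- coboundaries: `p^d Ψ̃ = ι∘ψ̃ + ∂b`, `p^d∘φ' mod T^{2e} = S^aΦ + ∂b₁`, `Ψc = ψ̃ mod T^{2e} + ∂b₂`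
  obtain ⟨b, hb⟩ := exists_coboundary_nsmul_sub_map W p κ.invTwist d (J + 1) ι Ψt ψt (by rw [hΨt, hψt]; exact hpΨ)
  obtain ⟨b₁, hb₁⟩ := exists_coboundary_castLE_geomTorsionPowToModP_eq W p I d s' a κ' hκ'a hJe Φ hΦ φ' hφ'
  have hΨcclass : oneCocycleClass (W.modPTwist p κ.invTwist (2 * e' + 1 + 1)).toTopRep Ψc =
      oneCocycleClass (W.modPTwist p κ.invTwist (2 * e' + 1 + 1)).toTopRep
        (κ.invTwist.pushCocycle (W.torsionGaloisModule (p : ℤ))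
          (fun P : geomTorsion W (p : ℤ) => AddSubgroup.torsionBy.nsmul P) (J + 1)
          (κ.invTwist.twistModPTruncate (W.torsionGaloisModule (p : ℤ)) _ (J + 1) hJe) ψt) := by
    rw [hΨc, ← hψt]
    exact ZpExtension.map_oneCocycleClass_twist κ.invTwist (W.torsionGaloisModule (p : ℤ)) _ (J + 1)
      (κ.invTwist.twistModPTruncate (W.torsionGaloisModule (p : ℤ)) _ (J + 1) hJe) ψt
  obtain ⟨b₂, hb₂⟩ := exists_coboundary_of_oneCocycleClass_eq _ hΨcclass
  have hVω' : ∀ i, i < J + 1 → ((p ^ (d + 1) : ℕ) : ℤ) ∣ (V * ((X + 1 : ℤ[X]) ^ (e' + 1) - 1)).coeff i :=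
    fun i hi => by rw [Nat.cast_pow]; exact hVω i hi
  have htdiv : e' + 1 ∣ κ.invTwist.twistExponent (J + 1 + (d + 1)) (absGaloisRestrict ℚ (q.adicCompletion ℚ) r) := by
    rw [he]; exact κ.invTwist.prime_pow_dvd_twistExponent hNL hrN'
  have hcomp : ∀ (P : geomTorsion W ((p : ℤ) ^ (d + 1))) (Q : geomTorsion W (p : ℤ)),
      ek P (ιh Q) = j ((c • e₁) (red P) Q) := fun P Q => by
    rw [hbridge, AddMonoidHom.smul_apply, AddMonoidHom.smul_apply]
  have jinj : Function.Injective j := muInclusion_injective (p := p) (d := d)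
  -- STEP 4ᵍ, level `L = J+1`: the mod-`p` identity for `(U(S)·S^{L−e}·(p^d∘φ')(r), ψ̃(r))`
  have key : ∀ i, i + ε < J + 1 →
      convCoeff e₁ (J + 1) i
        (aeval (shiftEnd (geomTorsion W (p : ℤ)) (J + 1)) U
          ((shiftEnd (geomTorsion W (p : ℤ)) (J + 1) ^ (J + 1 - (e' + 1)))
            (fun l => red (φ'.1 (absGaloisRestrict ℚ (q.adicCompletion ℚ) r) l))))
        (ψt.1 (absGaloisRestrict ℚ (q.adicCompletion ℚ) r)) = 0 := by
    intro i hi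
    have hiL : i < J + 1 := by omega
    have h0 := hvan i hi
    have hφval : (p ^ d • φ').1 (absGaloisRestrict ℚ (q.adicCompletion ℚ) r) =
        p ^ d • φ'.1 (absGaloisRestrict ℚ (q.adicCompletion ℚ) r) := rfl
    rw [hφval, map_nsmul, convCoeff_nsmul_left_eq_right, hb, convCoeff_add_right,
      convCoeff_aeval_comm ek V hiL (φ'.1 _) (W.modPkTwist p (d + 1) κ.invTwist (J + 1) _ b - b),
      modPkTwist_apply_of_forall_smul_eq W p κ.invTwist (d + 1) (J + 1) hsplitk b,
      aeval_shiftEnd_unipotentPow_sub_eq_zero (W.pow_nsmul_geomTorsion_eq_zero p (d + 1)) V hVω' htdiv b,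
      show convCoeff ek (J + 1) i (φ'.1 (absGaloisRestrict ℚ (q.adicCompletion ℚ) r)) 0 = 0 from
        map_zero (convCoeffHom ek (J + 1) i _), add_zero] at h0
    have h1 : convCoeff ek (J + 1) i (aeval (shiftEnd (geomTorsion W ((p : ℤ) ^ (d + 1))) (J + 1)) V
        (φ'.1 (absGaloisRestrict ℚ (q.adicCompletion ℚ) r))) (fun l => ιh (ψt.1 (absGaloisRestrict ℚ (q.adicCompletion ℚ) r) l)) = 0 := h0
    rw [convCoeff_comp_right_eq_map ek (c • e₁) red ιh j hcomp (J + 1) i] at h1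
    have h2 := jinj (h1.trans (map_zero j).symm)
    rw [convCoeff_zsmul_pairing, map_aeval_shiftEnd_apply red V] at h2
    have h3 := eq_zero_of_zsmul_eq_zero_of_not_dvd hp (natCast_zsmul_muCarrier_eq_zero ℚ p _) hpc h2
    rwa [convCoeff_aeval_left_eq_of_forall_dvd_coeff_sub e₁ (fun y : geomTorsion W (p : ℤ) => AddSubgroup.torsionBy.nsmul y)
      V (U * X ^ (J + 1 - (e' + 1))) hVU hiL, map_mul, map_pow, aeval_X, Module.End.mul_apply] at h3
  -- level change `L → 2e` and the coboundaries `b₁`, `b₂` (killed by `S^e`)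
  obtain ⟨y₁, hy₁⟩ := exists_modPTwist_sub_eq_shiftEnd_pow W p κ hN2 hsplit1 hrN b₁
  obtain ⟨y₂, hy₂⟩ := exists_modPTwist_sub_eq_shiftEnd_pow W p κ.invTwist hN2 hsplit1 hrN' b₂
  rw [← he] at hy₁ hy₂
  have hS2e : shiftEnd (geomTorsion W (p : ℤ)) (2 * e' + 1 + 1) ^ (e' + 1 + (e' + 1)) = 0 :=
    shiftEnd_pow_eq_zero (by omega)
  have hloc : ∃ U' : ℤ[X], ¬ ((p : ℤ) ∣ U'.coeff 0) ∧ ∀ i, i + ε < 2 * e' + 1 + 1 →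
      convCoeff e₁ (2 * e' + 1 + 1) i
        (aeval (shiftEnd (geomTorsion W (p : ℤ)) (2 * e' + 1 + 1)) U'
          ((shiftEnd (geomTorsion W (p : ℤ)) (2 * e' + 1 + 1) ^ (e' + 1))
            ((κ.shiftPowCocycle (W.torsionGaloisModule (p : ℤ))
              (fun P : geomTorsion W (p : ℤ) => AddSubgroup.torsionBy.nsmul P) (2 * e' + 1 + 1) a Φ).1
              (absGaloisRestrict ℚ (q.adicCompletion ℚ) r))))
        (Ψc.1 (absGaloisRestrict ℚ (q.adicCompletion ℚ) r)) = 0 := by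
    refine ⟨U, hU0, fun i hi => ?_⟩
    have hi2 : i < 2 * e' + 1 + 1 := by omega
    have h5 := convCoeff_castLE_aeval_shiftEnd_pow_eq e₁ hJe U (e' + 1)
      (fun l => red (φ'.1 (absGaloisRestrict ℚ (q.adicCompletion ℚ) r) l))
      (ψt.1 (absGaloisRestrict ℚ (q.adicCompletion ℚ) r)) hi2
    rw [show J + 1 - (2 * e' + 1 + 1) + (e' + 1) = J + 1 - (e' + 1) by omega,
      key (J + 1 - (2 * e' + 1 + 1) + i) (by omega)] at h5
    -- `h5 : C_i(U(S)·S^e·X̄, Ȳ) = 0` with `X̄ = S^aΦ(r) + S^e y₁`, `Ȳ = Ψc(r) − S^e y₂`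
    have hz1 : aeval (shiftEnd (geomTorsion W (p : ℤ)) (2 * e' + 1 + 1)) U
        ((shiftEnd (geomTorsion W (p : ℤ)) (2 * e' + 1 + 1) ^ (e' + 1))
          ((shiftEnd (geomTorsion W (p : ℤ)) (2 * e' + 1 + 1) ^ (e' + 1)) y₁)) = 0 := by
      rw [← Module.End.mul_apply (shiftEnd _ _ ^ (e' + 1)), ← pow_add, hS2e, LinearMap.zero_apply, map_zero]
    have hz2 : ∀ x : Fin (2 * e' + 1 + 1) → geomTorsion W (p : ℤ),
        convCoeff e₁ (2 * e' + 1 + 1) i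
          (aeval (shiftEnd (geomTorsion W (p : ℤ)) (2 * e' + 1 + 1)) U
            ((shiftEnd (geomTorsion W (p : ℤ)) (2 * e' + 1 + 1) ^ (e' + 1)) x))
          ((shiftEnd (geomTorsion W (p : ℤ)) (2 * e' + 1 + 1) ^ (e' + 1)) y₂) = 0 := fun x => by
      rw [← convCoeff_shiftEnd_pow_comm e₁ hi2, ← aeval_shiftEnd_pow_apply,
        ← Module.End.mul_apply (shiftEnd _ _ ^ (e' + 1)), ← pow_add, hS2e, LinearMap.zero_apply, map_zero]
      exact map_zero ((convCoeffHom e₁ (2 * e' + 1 + 1) i).flip _)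
    have hy₂' : (W.modPTwist p κ.invTwist (2 * e' + 1 + 1)).toTopRep.ρ (absGaloisRestrict ℚ (q.adicCompletion ℚ) r) b₂ -
        b₂ = (shiftEnd (geomTorsion W (p : ℤ)) (2 * e' + 1 + 1) ^ (e' + 1)) y₂ := hy₂
    rw [ZpExtension.shiftPowCocycle_apply, hb₂, ZpExtension.pushCocycle_apply, convCoeff_add_right, hy₂', hz2, add_zero]
    rw [hb₁, hy₁, map_add, map_add, convCoeff_add_left, hz1,
      show convCoeff e₁ (2 * e' + 1 + 1) i (0 : Fin (2 * e' + 1 + 1) → geomTorsion W (p : ℤ))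
        (fun l => ψt.1 (absGaloisRestrict ℚ (q.adicCompletion ℚ) r) (Fin.castLE hJe l)) = 0 from
        map_zero ((convCoeffHom e₁ (2 * e' + 1 + 1) i).flip _), add_zero] at h5
    exact h5
  -- the cocycles `S^aΦ` and `Ψc` vanish on the inertia group at `q`
  have hιinj : ∀ P : geomTorsion W (p : ℤ), ι P = 0 → P = 0 := fun P hP =>
    Subtype.ext (by rw [← hι P, hP]; rfl)
  have hΨI : ∀ τ ∈ absInertia (q.adicCompletion ℚ), Ψc.1 (absGaloisRestrict ℚ (q.adicCompletion ℚ) τ) = 0 := by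
    intro τ hτ
    have hΨt0 : Ψt.1 (absGaloisRestrict ℚ (q.adicCompletion ℚ) τ) = 0 :=
      apply_absGaloisRestrict_eq_zero_of_unramified_modPkTwist W p κ.invTwist (d + 1) (J + 1) q hurk hqp Ψt
        (by rw [hΨt]; exact hΨur q hq) hτ
    have hbτ : W.modPkTwist p (d + 1) κ.invTwist (J + 1) (absGaloisRestrict ℚ (q.adicCompletion ℚ) τ) b = b :=
      toLocal_modPkTwist_apply_of_mem_absInertia W p κ.invTwist (d + 1) (J + 1) q hurk hqp hτ b
    have hψt0 : ψt.1 (absGaloisRestrict ℚ (q.adicCompletion ℚ) τ) = 0 := by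
      have h := hb (absGaloisRestrict ℚ (q.adicCompletion ℚ) τ)
      rw [hΨt0, smul_zero, hbτ, sub_self, add_zero] at h
      funext l
      exact hιinj _ (congrFun h l).symm
    have hb₂τ : (W.modPTwist p κ.invTwist (2 * e' + 1 + 1)).toTopRep.ρ (absGaloisRestrict ℚ (q.adicCompletion ℚ) τ) b₂ =
        b₂ :=
      LocalSplitPrime.toLocal_twistModP_apply_of_mem_absInertia (W.torsionGaloisModule (p : ℤ))
        (fun P : geomTorsion W (p : ℤ) => AddSubgroup.torsionBy.nsmul P) κ.invTwist (2 * e' + 1 + 1) q hur hqp hτ b₂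
    rw [hb₂, ZpExtension.pushCocycle_apply, hψt0, hb₂τ, sub_self, add_zero, map_zero]
  have hΦ'cl : oneCocycleClass (κ.twistModP (W.torsionGaloisModule (p : ℤ))
      (fun P : geomTorsion W (p : ℤ) => AddSubgroup.torsionBy.nsmul P) (2 * e' + 1 + 1)).toTopRep
      (κ.shiftPowCocycle (W.torsionGaloisModule (p : ℤ))
        (fun P : geomTorsion W (p : ℤ) => AddSubgroup.torsionBy.nsmul P) (2 * e' + 1 + 1) a Φ) =
      (I.redTower s').1 (2 * e' + 1 + 1) := by
    rw [← ZpExtension.shiftH1_iterate_oneCocycleClass, ← hκ'a, ZpExtension.towerShift_iterate_apply_coe]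
    exact congrArg _ hΦ
  have hΦ'I : ∀ τ ∈ absInertia (q.adicCompletion ℚ),
      (κ.shiftPowCocycle (W.torsionGaloisModule (p : ℤ))
        (fun P : geomTorsion W (p : ℤ) => AddSubgroup.torsionBy.nsmul P) (2 * e' + 1 + 1) a Φ).1
        (absGaloisRestrict ℚ (q.adicCompletion ℚ) τ) = 0 := fun τ hτ =>
    StepFour.apply_absGaloisRestrict_eq_zero_of_localization_mem_unramified κ (W.torsionGaloisModule (p : ℤ))
      (fun P : geomTorsion W (p : ℤ) => AddSubgroup.torsionBy.nsmul P) (2 * e' + 1 + 1) q hur hqp _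
      (by rw [hΦ'cl]; exact TameClass.localization_redTower_mem_unramifiedSubgroup W p κ γ I s' _ hqp hur) hτ
  -- transport to the stub's `(𝔓, Fr)`
  have he' : ∀ (g : absoluteGaloisGroup ℚ) (m m' : geomTorsion W (p : ℤ)),
      e₁ (g • m) (g • m') = DiscreteGaloisModule.mu ℚ p g (e₁ m m') := fun g m m' => by
    rw [← WeierstrassCurve.torsionGaloisModule_apply_apply, ← WeierstrassCurve.torsionGaloisModule_apply_apply]
    exact StepFour.weilPairingHom_torsionGaloisModule_smul W p eW hμ hadd₁ hadd₂ hgal g m m'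
  have hnJ : N + 1 ≤ 2 * e' + 1 + 1 := by have := Nat.lt_pow_self hp.one_lt (n := N); omega
  have hJm : 2 * e' + 1 + 1 ≤ (e' + 1) + p ^ N := by rw [← he]; omega
  obtain ⟨U', hU'0, hU'⟩ :=
    StepsTwoFourTransport.exists_forall_convCoeff_aeval_eq_zero_of_isAbsArithFrob W p κ
      (DiscreteGaloisModule.mu ℚ p) he' hnJ hJm _ Ψc hqp hur hΦ'I hΨI hr hloc h𝔓 hFr hρFr hFrN hFrN1
  refine ⟨U', hU'0, fun i hi => ?_⟩
  have h := hU' i hi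
  rw [ZpExtension.shiftPowCocycle_apply, ← Module.End.mul_apply (shiftEnd _ _ ^ (e' + 1)), ← pow_add] at h
  exact h

end Summit.BirchSwinnertonDyer.BirchSwinnertonDyer.Theorems.OneSidedTwistSqueezeX9KatoDivisibilityX9StubReciprocityPkAX9Assembly

end
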